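import Literature.Barriers.Parity.ElliottOriginalForm
import Literature.NumberTheory.LFunctions.LiouvilleNonpretentious
import Literature.NumberTheory.LFunctions.DirichletPolynomialMeanValue

/-!
# Matomäki–Radziwiłł–Tao, Theorem B.1, PROVED: Elliott's conjecture in its original form is false

Topic `Literature/Barriers/Parity` (sibling proofs file of `ElliottOriginalForm`). Everything in this
file is PROVED (no `sorry`, no named facts):

* `Literature.Barriers.Parity.MatomakiRadziwillTao2015_counterexample_holds` — DISCHARGE of the named fact
  `Literature.Barriers.Parity.MatomakiRadziwillTao2015_counterexample` (Matomäki–Radziwiłł–Tao 2015, Appendix B,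
  Theorem B.1): there is a `1`-bounded multiplicative `g : ℕ → ℂ` with `M(g; ∞, ∞) = ∞`
  (`IsPointwiseNonpretentious g`: `𝔻(g, χ(n)n^{it}; x)² → ∞` for EVERY fixed Dirichlet character `χ`
  and EVERY fixed real `t`) and a sequence of scales `T_m → ∞` with
  `|∑_{n ≤ T_m} g(n) conj g(n+1)| ≥ T_m / 50` for all `m`;
* `Literature.Barriers.Parity.ElliottConjectureOriginal_false : ¬ ElliottConjectureOriginal` — Elliott's conjecture
  as originally formulated (MRT Conjecture 1.5 with hypothesis (1.6)) is false, by the above and the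
  already proved `MatomakiRadziwillTao2015_counterexample.not_elliottConjectureOriginal`.

In particular the statement `ElliottConjectureOriginal` of `ElliottOriginalForm` can NOT be
discharged: its negation is a theorem. Since the verdict clean-up of 2026-08-16 that definition is
kept in `ElliottOriginalForm.lean`, statement byte-for-byte, only as a `@[deprecated]` tombstone (it
cannot be deleted while this refutation names it), which is why `linter.deprecated` is switched off
for `ElliottConjectureOriginal_false` alone.

## The proof (MRT Appendix B, with two simplifications)

The source [cite: MatomakiRadziwillTao2015, Appendix B (proof of Theorem B.1)] builds `t₁ < t₂ < ⋯`
and unimodular `g(p) = p^{i s_{m+1}}` on `t_m < p ≤ t_{m+1} = s_{m+1}²`, choosing `s_{m+1}` by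
Kronecker's theorem so that `p^{i s_{m+1}} = g(p)(1 + O(t_m^{-2}))` for all `p ≤ t_m`, sets
`g(n) = μ²(n) ∏_{p ∣ n} g(p)`, gets `g(n) conj g(n+1) = μ²(n)μ²(n+1) + O(1/t_m)` on
`t_{m+1}^{3/4} ≤ n < t_{m+1}` ("`μ²(n)μ²(n+1)` has positive mean value"), and proves `M(g;∞,∞) = ∞`
from the primes `exp((log t_{m+1})^{5/6}) < p ≤ t_{m+1}` via the Vinogradov–Korobov region
("as in (2.3)"). We follow this architecture (`MRTCounterexample.stage`, `.g`) with:

1. **Recurrence instead of Kronecker** (`exists_shift`). We take `s_{j+1} = s_j + u_{j+1}` where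
   `u_{j+1} ≥ j + 2` and `|p^{i u_{j+1}} - 1| ≤ η 2^{-(j+1)} / (t_j + 1)²` for all `p ≤ t_j`
   (`η = 1/100`); such `u` exists because the orbit `m ↦ (p^{imL})_{p ≤ t_j}` in the compact torus
   has two close points (Bolzano–Weierstrass, Mathlib `IsCompact.tendsto_subseq`). Then
   `|g(p) - p^{i s_{m+1}}| ≤ η / p²` for every prime `p ≤ t_{m+1}` (`gp_near`), hence
   `|g(n) - n^{i s_{m+1}}| ≤ η ∑_{p ∣ n} p^{-2} ≤ η` for square-free `n ≤ t_{m+1}` (`g_near`).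
2. **van der Corput instead of Vinogradov–Korobov** (`exists_block`). The tree already proves
   (D1c) `𝔻(1, n^{iu}; x)² = log log x - log|ζ(σ_x - iu)| + O(1)`
   (`Literature.NumberTheory.LFunctions.exists_pretentiousDistSq_one_zeta_approx`) and `log|ζ(σ_x - iu)| ≤ log log x - B` for
   `2 ≤ |u| ≤ x²`, `x ≥ x₁(B)` (`Literature.NumberTheory.LFunctions.log_norm_zeta_sigmaX_le`, from `VanDerCorputZeta`). So
   `t_{j+1}` can be chosen (after `s_{j+1}`) so large that
   `𝔻(1, n^{iu}; t_{j+1})² - 𝔻(1, n^{iu}; t_j)² ≥ 1` for all `2 ≤ |u| ≤ 4(j+1)s_{j+1}`, and also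
   `t_{j+1} ≥ 60000(s_{j+1} + 1)`. For fixed `χ` mod `q`, `t`, and `k = 2φ(q)`, the `k`-trick
   `1 - Re p^{ik(s_j - t)} ≤ k²(1 - Re g(p) conj(χ(p)p^{it}))` (`kTrick`; `χ(p)^{φ(q)} = 1`) shows that
   every block `j ≥ max(q, |t|)` adds at least `1/k²` to `𝔻(g, χ(n)n^{it}; ·)²`
   (`g_isPointwiseNonpretentious`).
3. **Correlation** (`corr_lower`): with `T = t_{m+1}`, `s = s_{m+1}`, for `n, n+1` square-free,
   `100 s ≤ n < T`: `|g(n) conj g(n+1) - 1| ≤ 2η + s/n ≤ 3η` (`corr_term_near`), and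
   `#{n ≤ X : n, n+1 square-free} ≥ X/40 - 1` (`card_sqfreePairs_ge`, union bound with
   `∑_p p^{-2} ≤ 0.48`), giving `Re ∑_{n ≤ T} g(n) conj g(n+1) ≥ T/50`.

## References
* K. Matomäki, M. Radziwiłł, T. Tao, *An averaged form of Chowla's conjecture*, Algebra & Number
  Theory 9 (2015), 2167–2196; arXiv:1503.05121: §1 (Conjecture 1.5, (1.6)–(1.8)), Appendix B
  (Theorem B.1 and its proof). [cite: MatomakiRadziwillTao2015, Appendix B, Theorem B.1]
* For the analytic inputs see `Literature/NumberTheory/LFunctions/PretentiousZeta.lean` and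
  `Literature/NumberTheory/LFunctions/LiouvilleNonpretentious.lean` (van der Corput via
  `VanDerCorputZeta`).

## Design choices
* All constants are explicit (`η = 1/100`, `c = 1/50`, `t_{j+1} ≥ 60000(s_{j+1}+1)`); the stages are a
  `Classical.choose` recursion `MRTCounterexample.stage : ℕ → ℕ × ℝ` with `(t₀, s₀) = (0, 0)`.
* The scales of Theorem B.1 are `T m = t_{m+1}` (natural numbers), and the lower bound holds for
  every `m` (the fact asks for it eventually).
* Internal lemmas live in the namespace `Literature.Barriers.MRTCounterexample`; only the two theorems
  above are in `Literature.Barriers`. `conj e^{iθ} = e^{-iθ}` is `Literature.NumberTheory.LFunctions.conj_exp_ofReal_mul_I`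
  (`DirichletPolynomialMeanValue`), the unimodular-power inequalities are
  `Literature.NumberTheory.LFunctions.norm_one_sub_pow_le_of_norm_one`, `Literature.NumberTheory.LFunctions.norm_one_sub_sq_of_norm_one` (`LiouvilleNonpretentious`).
-/

noncomputable section

open Filter Finset Complex
open scoped ComplexConjugate

namespace Literature.Barriers.Parity.MRTCounterexample

/-! ### Elementary facts about unimodular phases `e(θ) = exp(iθ)` -/

/-- `p^{it} = e^{i t log p}` for a positive natural `p`. [folklore] -/
theorem natCast_cpow_mul_I {p : ℕ} (hp : 0 < p) (t : ℝ) :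
    (p : ℂ) ^ ((t : ℂ) * I) = Complex.exp (((t * Real.log p : ℝ) : ℂ) * I) := by
  have hp0 : (p : ℂ) ≠ 0 := by exact_mod_cast hp.ne'
  rw [cpow_def_of_ne_zero hp0, ← Complex.natCast_log]
  congr 1
  push_cast
  ring

/-- `|e^{iθ}| = 1`. [folklore] -/
theorem norm_phase (θ : ℝ) : ‖Complex.exp ((θ : ℂ) * I)‖ = 1 := norm_exp_ofReal_mul_I θ

/-- `e^{iθ₁} e^{iθ₂} = e^{i(θ₁+θ₂)}`. [folklore] -/
theorem phase_mul_phase (θ₁ θ₂ : ℝ) :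
    Complex.exp ((θ₁ : ℂ) * I) * Complex.exp ((θ₂ : ℂ) * I) = Complex.exp (((θ₁ + θ₂ : ℝ) : ℂ) * I) := by
  rw [← Complex.exp_add]
  congr 1
  push_cast
  ring

/-- `(e^{iθ})^k = e^{ikθ}`. [folklore] -/
theorem phase_pow (θ : ℝ) (k : ℕ) :
    Complex.exp ((θ : ℂ) * I) ^ k = Complex.exp ((((k : ℝ) * θ : ℝ) : ℂ) * I) := by
  rw [← Complex.exp_nat_mul]
  congr 1
  push_cast
  ring

/-- `|e^{iθ} - 1| ≤ |θ|`. [folklore] -/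
theorem norm_phase_sub_one_le (θ : ℝ) : ‖Complex.exp ((θ : ℂ) * I) - 1‖ ≤ |θ| := by
  have h := Real.norm_exp_I_mul_ofReal_sub_one_le (x := θ)
  rw [mul_comm] at h
  simpa [Real.norm_eq_abs] using h

/-- `Re e^{iθ} ≤ 1`, i.e. the summands `1 - Re e^{iθ}` are nonnegative. [folklore] -/
theorem one_sub_re_phase_nonneg (θ : ℝ) : 0 ≤ 1 - (Complex.exp ((θ : ℂ) * I)).re := by
  have h := Complex.re_le_norm (Complex.exp ((θ : ℂ) * I))
  rw [norm_phase] at h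
  linarith

/-- `|∏ aᵢ - ∏ bᵢ| ≤ ∑ |aᵢ - bᵢ|` for `|aᵢ|, |bᵢ| ≤ 1`. [folklore] -/
theorem norm_prod_sub_prod_le {ι : Type*} (s : Finset ι) {a b : ι → ℂ}
    (ha : ∀ i ∈ s, ‖a i‖ ≤ 1) (hb : ∀ i ∈ s, ‖b i‖ ≤ 1) :
    ‖∏ i ∈ s, a i - ∏ i ∈ s, b i‖ ≤ ∑ i ∈ s, ‖a i - b i‖ := by
  classical
  induction s using Finset.induction_on with
  | empty => simp
  | insert j s hj ih =>
    rw [Finset.prod_insert hj, Finset.prod_insert hj, Finset.sum_insert hj]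
    have ha' : ∀ i ∈ s, ‖a i‖ ≤ 1 := fun i hi => ha i (Finset.mem_insert_of_mem hi)
    have hb' : ∀ i ∈ s, ‖b i‖ ≤ 1 := fun i hi => hb i (Finset.mem_insert_of_mem hi)
    have hbj : ‖∏ i ∈ s, b i‖ ≤ 1 := by
      rw [norm_prod]
      exact Finset.prod_le_one (fun i _ => norm_nonneg _) hb'
    have h : a j * ∏ i ∈ s, a i - b j * ∏ i ∈ s, b i
        = a j * (∏ i ∈ s, a i - ∏ i ∈ s, b i) + (a j - b j) * ∏ i ∈ s, b i := by ring
    calc ‖a j * ∏ i ∈ s, a i - b j * ∏ i ∈ s, b i‖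
        = ‖a j * (∏ i ∈ s, a i - ∏ i ∈ s, b i) + (a j - b j) * ∏ i ∈ s, b i‖ := by rw [h]
      _ ≤ ‖a j * (∏ i ∈ s, a i - ∏ i ∈ s, b i)‖ + ‖(a j - b j) * ∏ i ∈ s, b i‖ := norm_add_le _ _
      _ ≤ 1 * ‖∏ i ∈ s, a i - ∏ i ∈ s, b i‖ + ‖a j - b j‖ * 1 := by
          rw [norm_mul, norm_mul]
          gcongr
          exact ha j (Finset.mem_insert_self j s)
      _ ≤ ‖a j - b j‖ + ∑ i ∈ s, ‖a i - b i‖ := by linarith [ih ha' hb']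

/-- `∑_{a < k ≤ K} 1/k² ≤ 1/a` for `a ≥ 1` (telescoping against `1/(k(k-1))`). [folklore] -/
theorem sum_Icc_inv_sq_le (a K : ℕ) (ha : 1 ≤ a) :
    ∑ k ∈ Finset.Icc (a + 1) K, (1 : ℝ) / (k : ℝ) ^ 2 ≤ 1 / a := by
  rcases le_or_gt K a with hK | hK
  · rw [Finset.Icc_eq_empty (by omega), Finset.sum_empty]
    positivity
  · -- `∑_{a < k ≤ K} 1/k² ≤ 1/a - 1/K` for `K ≥ a`
    suffices h : ∀ K : ℕ, a ≤ K → ∑ k ∈ Finset.Icc (a + 1) K, (1 : ℝ) / (k : ℝ) ^ 2 ≤ 1 / a - 1 / K by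
      have hKpos : (0 : ℝ) < K := by exact_mod_cast (lt_of_le_of_lt (Nat.zero_le a) hK)
      linarith [h K hK.le, one_div_pos.2 hKpos]
    intro K hK
    induction K, hK using Nat.le_induction with
    | base =>
      rw [Finset.Icc_eq_empty (by omega), Finset.sum_empty]
      simp
    | succ K hK ih =>
      rw [Finset.sum_Icc_succ_top (by omega)]
      have hK0 : (0 : ℝ) < K := by exact_mod_cast (lt_of_lt_of_le ha hK)
      have hK1 : (0 : ℝ) < (K : ℝ) + 1 := by linarith
      have key : (1 : ℝ) / ((K + 1 : ℕ) : ℝ) ^ 2 ≤ 1 / K - 1 / ((K + 1 : ℕ) : ℝ) := by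
        push_cast
        rw [div_sub_div _ _ hK0.ne' hK1.ne', div_le_div_iff₀ (by positivity) (by positivity)]
        nlinarith
      linarith

/-! ### Recurrence of `t ↦ (p^{it})_{p ≤ T}` (replaces Kronecker's theorem in MRT's proof)

For every finite set of primes, every `ε > 0` and every `L`, there is `u ≥ L` with
`|p^{iu} - 1| ≤ ε` for all `p ≤ T`: the orbit `m ↦ (p^{imL'})_{p ≤ T}` in the compact torus has two
close points `m₁ < m₂` (Bolzano–Weierstrass), and `u = (m₂ - m₁) L'` works. -/

/-- **Recurrence.** `∃ u ≥ L, ∀ p ≤ T prime, |e^{iu log p} - 1| ≤ ε`. [folklore] -/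
theorem exists_shift (T : ℕ) {ε : ℝ} (hε : 0 < ε) (L : ℝ) :
    ∃ u : ℝ, L ≤ u ∧ ∀ p ∈ Nat.primesLE T,
      ‖Complex.exp (((u * Real.log p : ℝ) : ℂ) * I) - 1‖ ≤ ε := by
  set L' : ℝ := max L 1 with hL'
  have hL'1 : 1 ≤ L' := le_max_right _ _
  -- the orbit in the torus `(primesLE T) → ℂ`
  let v : ℕ → (Nat.primesLE T → ℂ) := fun m p =>
    Complex.exp ((((m : ℝ) * L' * Real.log (p : ℕ) : ℝ) : ℂ) * I)
  have hv : ∀ m, v m ∈ Set.univ.pi (fun _ : Nat.primesLE T => Metric.closedBall (0 : ℂ) 1) := by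
    intro m p _
    simp only [Metric.mem_closedBall, dist_zero_right, v]
    exact (norm_phase _).le
  have hK : IsCompact (Set.univ.pi (fun _ : Nat.primesLE T => Metric.closedBall (0 : ℂ) 1)) :=
    isCompact_univ_pi fun _ => isCompact_closedBall _ _
  obtain ⟨a, -, φ, hφ, hlim⟩ := hK.tendsto_subseq hv
  have hC : CauchySeq (v ∘ φ) := hlim.cauchySeq
  obtain ⟨N, hN⟩ := Metric.cauchySeq_iff'.1 hC ε hε
  have hdist : dist (v (φ (N + 1))) (v (φ N)) < ε := hN (N + 1) (Nat.le_succ N)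
  have hlt : φ N < φ (N + 1) := hφ (Nat.lt_succ_self N)
  set k : ℕ := φ (N + 1) - φ N with hk
  have hk1 : 1 ≤ k := by omega
  have hsum : φ (N + 1) = φ N + k := by omega
  refine ⟨(k : ℝ) * L', ?_, fun p hp => ?_⟩
  · calc L ≤ L' := le_max_left _ _
      _ = 1 * L' := (one_mul _).symm
      _ ≤ (k : ℝ) * L' := by gcongr; exact_mod_cast hk1
  · have h1 : dist (v (φ (N + 1)) ⟨p, hp⟩) (v (φ N) ⟨p, hp⟩) ≤ dist (v (φ (N + 1))) (v (φ N)) :=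
      dist_le_pi_dist _ _ _
    have h2 : dist (v (φ (N + 1)) ⟨p, hp⟩) (v (φ N) ⟨p, hp⟩)
        = ‖Complex.exp ((((k : ℝ) * L' * Real.log p : ℝ) : ℂ) * I) - 1‖ := by
      rw [dist_eq_norm]
      simp only [v, hsum]
      have e : (((((φ N + k : ℕ) : ℝ) * L' * Real.log p : ℝ) : ℂ) * I)
          = ((((φ N : ℕ) : ℝ) * L' * Real.log p : ℝ) : ℂ) * I
            + ((((k : ℝ) * L' * Real.log p : ℝ) : ℂ) * I) := by
        push_cast
        ring
      rw [e, Complex.exp_add, ← mul_sub_one, norm_mul, norm_phase, one_mul]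
    linarith [h1, h2.symm.le, hdist.le, h2.le]

/-! ### Blocks of primes on which `n^{iu}` is far from `1`, uniformly in `2 ≤ |u| ≤ U` -/

/-- `𝔻(1, n^{iu}; x)²` in short.
[cite: MatomakiRadziwillTao2015, Appendix B (proof of Theorem B.1)] -/
abbrev D1 (u x : ℝ) : ℝ := Literature.NumberTheory.Sieve.pretentiousDistSq 1 (Literature.NumberTheory.Sieve.twistedChar (1 : DirichletCharacter ℂ 1) u) x

/-- `𝔻(1, n^{iu}; X)² = ∑_{p ≤ X} (1 - Re e^{iu log p})/p` for a natural height `X`. [folklore] -/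
theorem D1_natCast (u : ℝ) (X : ℕ) :
    D1 u X = ∑ p ∈ Nat.primesLE X, (1 - (Complex.exp (((u * Real.log p : ℝ) : ℂ) * I)).re) / (p : ℝ) := by
  unfold D1 Literature.NumberTheory.Sieve.pretentiousDistSq
  rw [Nat.floor_natCast]
  refine Finset.sum_congr rfl fun p hp => ?_
  have hp0 : 0 < p := (Nat.prime_of_mem_primesLE hp).pos
  rw [Literature.NumberTheory.Sieve.twistedChar, Literature.NumberTheory.LFunctions.dirichletCharacter_modOne_apply, one_mul, Pi.one_apply, one_mul, Complex.conj_re,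
    natCast_cpow_mul_I hp0]

/-- `0 ≤ 𝔻(1, n^{iu}; A)² ≤ 2 ∑_{p ≤ A} 1/p`. [folklore] -/
theorem D1_le (u : ℝ) (A : ℕ) : D1 u A ≤ ∑ p ∈ Nat.primesLE A, 2 / (p : ℝ) := by
  rw [D1_natCast]
  refine Finset.sum_le_sum fun p hp => ?_
  have hp0 : (0 : ℝ) < p := by exact_mod_cast (Nat.prime_of_mem_primesLE hp).pos
  refine div_le_div_of_nonneg_right ?_ hp0.le
  have h := abs_re_le_norm (Complex.exp (((u * Real.log p : ℝ) : ℂ) * I))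
  rw [norm_phase] at h
  linarith [neg_abs_le (Complex.exp (((u * Real.log p : ℝ) : ℂ) * I)).re]

/-- **Blocks.** For every `A`, `U`, `R` there is a natural `X > A`, `X ≥ R`, such that
`𝔻(1, n^{iu}; X)² - 𝔻(1, n^{iu}; A)² ≥ 1` for all `2 ≤ |u| ≤ U`: by the distance formula (D1c)
and van der Corput's bound, `𝔻(1, n^{iu}; x)² → ∞` uniformly in `2 ≤ |u| ≤ x²`. [folklore] -/
theorem exists_block (A : ℕ) (U R : ℝ) :
    ∃ X : ℕ, A < X ∧ R ≤ X ∧ ∀ u : ℝ, 2 ≤ |u| → |u| ≤ U → 1 ≤ D1 u X - D1 u A := by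
  obtain ⟨x₀, C, hx₀, hC⟩ := Literature.NumberTheory.LFunctions.exists_pretentiousDistSq_one_zeta_approx
  set M : ℝ := ∑ p ∈ Nat.primesLE A, 2 / (p : ℝ) with hM
  obtain ⟨x₁, hx₁⟩ := Literature.NumberTheory.LFunctions.log_norm_zeta_sigmaX_le (1 + M + C)
  set X : ℕ := ⌈max (max x₀ x₁) (max (max U 1) (max R ((A : ℝ) + 1)))⌉₊ with hX
  have hXge : max (max x₀ x₁) (max (max U 1) (max R ((A : ℝ) + 1))) ≤ (X : ℝ) := Nat.le_ceil _
  have hX0 : x₀ ≤ X := le_trans (by simp) hXge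
  have hX1 : x₁ ≤ X := le_trans (by simp) hXge
  have hXU : U ≤ X := le_trans (by simp) hXge
  have hXone : (1 : ℝ) ≤ X := le_trans (by simp) hXge
  have hXR : R ≤ X := le_trans (by simp) hXge
  have hXA : (A : ℝ) + 1 ≤ X := le_trans (by simp) hXge
  refine ⟨X, by exact_mod_cast (show (A : ℝ) < X by linarith), hXR, fun u hu2 huU => ?_⟩
  have hux : |u| ≤ (X : ℝ) ^ 2 := by nlinarith
  have h1 := hC X hX0 u
  have h2 := hx₁ X hX1 u hu2 hux
  have h3 : D1 u A ≤ M := D1_le u A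
  have h4 : 1 + M ≤ D1 u X := by
    have := (abs_le.1 h1).1
    unfold D1
    linarith
  linarith

/-! ### The construction

`η = 1/100`. Stage `j+1` from stage `j` (`t_j : ℕ`, `s_j : ℝ`, `t₀ = s₀ = 0`):
`s_{j+1} = s_j + u` with `u ≥ j+2` and `|p^{iu} - 1| ≤ η 2^{-(j+1)} / (t_j+1)²` for all `p ≤ t_j`
(`exists_shift`), then `t_{j+1} > t_j`, `t_{j+1} ≥ 60000(s_{j+1}+1)`, with
`𝔻(1,n^{iu};t_{j+1})² - 𝔻(1,n^{iu};t_j)² ≥ 1` for all `2 ≤ |u| ≤ 4(j+1)s_{j+1}` (`exists_block`). -/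

/-- The shift `u_{j+1}` at stage `j+1`, given `t_j = T`.
[cite: MatomakiRadziwillTao2015, Appendix B (proof of Theorem B.1)] -/
def shift (j T : ℕ) : ℝ :=
  Classical.choose (exists_shift T (ε := 1 / 100 * (1 / 2) ^ (j + 1) / ((T : ℝ) + 1) ^ 2)
    (by positivity) ((j : ℝ) + 2))

/-- The defining property of `shift j T` (from `exists_shift`).
[cite: MatomakiRadziwillTao2015, Appendix B (proof of Theorem B.1)] -/
theorem shift_spec (j T : ℕ) :
    (j : ℝ) + 2 ≤ shift j T ∧ ∀ p ∈ Nat.primesLE T,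
      ‖Complex.exp (((shift j T * Real.log p : ℝ) : ℂ) * I) - 1‖
        ≤ 1 / 100 * (1 / 2) ^ (j + 1) / ((T : ℝ) + 1) ^ 2 :=
  Classical.choose_spec (exists_shift T (ε := 1 / 100 * (1 / 2) ^ (j + 1) / ((T : ℝ) + 1) ^ 2)
    (by positivity) ((j : ℝ) + 2))

/-- The height `t_{j+1}` at stage `j+1`, given `t_j = T` and `s_{j+1} = s`.
[cite: MatomakiRadziwillTao2015, Appendix B (proof of Theorem B.1)] -/
def nextT (j T : ℕ) (s : ℝ) : ℕ :=
  Classical.choose (exists_block T (4 * ((j : ℝ) + 1) * s) (60000 * (s + 1)))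

/-- The defining property of `nextT j T s` (from `exists_block`).
[cite: MatomakiRadziwillTao2015, Appendix B (proof of Theorem B.1)] -/
theorem nextT_spec (j T : ℕ) (s : ℝ) :
    T < nextT j T s ∧ 60000 * (s + 1) ≤ (nextT j T s : ℝ) ∧
      ∀ u : ℝ, 2 ≤ |u| → |u| ≤ 4 * ((j : ℝ) + 1) * s → 1 ≤ D1 u (nextT j T s) - D1 u T :=
  Classical.choose_spec (exists_block T (4 * ((j : ℝ) + 1) * s) (60000 * (s + 1)))

/-- The sequence of stages `(t_j, s_j)`.
[cite: MatomakiRadziwillTao2015, Appendix B (proof of Theorem B.1)] -/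
def stage : ℕ → ℕ × ℝ
  | 0 => (0, 0)
  | j + 1 => (nextT j (stage j).1 ((stage j).2 + shift j (stage j).1),
      (stage j).2 + shift j (stage j).1)

/-- The heights `t_j`. [cite: MatomakiRadziwillTao2015, Appendix B (proof of Theorem B.1)] -/
def tt (j : ℕ) : ℕ := (stage j).1

/-- The frequencies `s_j`. [cite: MatomakiRadziwillTao2015, Appendix B (proof of Theorem B.1)] -/
def ss (j : ℕ) : ℝ := (stage j).2

/-- `t₀ = 0`. [cite: MatomakiRadziwillTao2015, Appendix B (proof of Theorem B.1)] -/
theorem tt_zero : tt 0 = 0 := rfl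

/-- `s₀ = 0`. [cite: MatomakiRadziwillTao2015, Appendix B (proof of Theorem B.1)] -/
theorem ss_zero : ss 0 = 0 := rfl

/-- `s_{j+1} = s_j + u_{j+1}`.
[cite: MatomakiRadziwillTao2015, Appendix B (proof of Theorem B.1)] -/
theorem ss_succ (j : ℕ) : ss (j + 1) = ss j + shift j (tt j) := rfl

/-- `t_{j+1}` is the block end chosen at stage `j+1`.
[cite: MatomakiRadziwillTao2015, Appendix B (proof of Theorem B.1)] -/
theorem tt_succ (j : ℕ) : tt (j + 1) = nextT j (tt j) (ss (j + 1)) := rfl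

/-- `t_j < t_{j+1}`. [cite: MatomakiRadziwillTao2015, Appendix B (proof of Theorem B.1)] -/
theorem tt_lt_tt_succ (j : ℕ) : tt j < tt (j + 1) := by
  rw [tt_succ]
  exact (nextT_spec j (tt j) (ss (j + 1))).1

/-- The heights `t_j` increase strictly.
[cite: MatomakiRadziwillTao2015, Appendix B (proof of Theorem B.1)] -/
theorem tt_strictMono : StrictMono tt := strictMono_nat_of_lt_succ tt_lt_tt_succ

/-- The heights `t_j` increase.
[cite: MatomakiRadziwillTao2015, Appendix B (proof of Theorem B.1)] -/
theorem tt_mono : Monotone tt := tt_strictMono.monotone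

/-- `t_j ≥ j`, so `t_j → ∞`. [cite: MatomakiRadziwillTao2015, Appendix B (proof of Theorem B.1)] -/
theorem le_tt (j : ℕ) : j ≤ tt j := by
  induction j with
  | zero => simp [tt_zero]
  | succ j ih => exact Nat.succ_le_of_lt (lt_of_le_of_lt ih (tt_lt_tt_succ j))

/-- `u_{j+1} = s_{j+1} - s_j ≥ j + 2`.
[cite: MatomakiRadziwillTao2015, Appendix B (proof of Theorem B.1)] -/
theorem le_ss_succ (j : ℕ) : (j : ℝ) + 2 ≤ ss (j + 1) - ss j := by
  rw [ss_succ]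
  linarith [(shift_spec j (tt j)).1]

/-- `s_j ≥ 0`. [cite: MatomakiRadziwillTao2015, Appendix B (proof of Theorem B.1)] -/
theorem ss_nonneg (j : ℕ) : 0 ≤ ss j := by
  induction j with
  | zero => simp [ss_zero]
  | succ j ih => linarith [le_ss_succ j]

/-- `s_{j+1} ≥ j + 2`, so `s_j → ∞`.
[cite: MatomakiRadziwillTao2015, Appendix B (proof of Theorem B.1)] -/
theorem ss_succ_ge (j : ℕ) : (j : ℝ) + 2 ≤ ss (j + 1) := by
  linarith [le_ss_succ j, ss_nonneg j]

/-- `t_{j+1} ≥ 60000 (s_{j+1} + 1)`: the scale `t_{j+1}` is large compared to the frequency `s_{j+1}`.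
[cite: MatomakiRadziwillTao2015, Appendix B (proof of Theorem B.1)] -/
theorem tt_succ_ge (j : ℕ) : 60000 * (ss (j + 1) + 1) ≤ (tt (j + 1) : ℝ) := by
  rw [tt_succ]
  exact (nextT_spec j (tt j) (ss (j + 1))).2.1

/-- **Block property**: `𝔻(1, n^{iu}; t_{j+1})² - 𝔻(1, n^{iu}; t_j)² ≥ 1` for `2 ≤ |u| ≤ 4(j+1)s_{j+1}`.
[cite: MatomakiRadziwillTao2015, Appendix B (proof of Theorem B.1)] -/
theorem block_ge_one (j : ℕ) (u : ℝ) (hu2 : 2 ≤ |u|) (huU : |u| ≤ 4 * ((j : ℝ) + 1) * ss (j + 1)) :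
    1 ≤ D1 u (tt (j + 1)) - D1 u (tt j) := by
  rw [tt_succ]
  exact (nextT_spec j (tt j) (ss (j + 1))).2.2 u hu2 huU

/-- **Shift property**: `|p^{iu_{j+1}} - 1| ≤ η 2^{-(j+1)}/(t_j+1)²` for all primes `p ≤ t_j`.
[cite: MatomakiRadziwillTao2015, Appendix B (proof of Theorem B.1)] -/
theorem shift_small (j : ℕ) {p : ℕ} (hp : p ∈ Nat.primesLE (tt j)) :
    ‖Complex.exp ((((ss (j + 1) - ss j) * Real.log p : ℝ) : ℂ) * I) - 1‖
      ≤ 1 / 100 * (1 / 2) ^ (j + 1) / ((tt j : ℝ) + 1) ^ 2 := by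
  rw [ss_succ, add_sub_cancel_left]
  exact (shift_spec j (tt j)).2 p hp

/-! ### The block index of a prime and the function `g` -/

/-- Every `p` lies below some height `t_j`.
[cite: MatomakiRadziwillTao2015, Appendix B (proof of Theorem B.1)] -/
theorem exists_le_tt (p : ℕ) : ∃ j, p ≤ tt j := ⟨p, le_tt p⟩

open Classical in
/-- The block index of `p`: the least `j` with `p ≤ t_j`.
[cite: MatomakiRadziwillTao2015, Appendix B (proof of Theorem B.1)] -/
def idx (p : ℕ) : ℕ := Nat.find (exists_le_tt p)

/-- `p ≤ t_{idx p}`. [cite: MatomakiRadziwillTao2015, Appendix B (proof of Theorem B.1)] -/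
theorem le_tt_idx (p : ℕ) : p ≤ tt (idx p) := by
  classical
  exact Nat.find_spec (exists_le_tt p)

/-- `idx p` is the least `j` with `p ≤ t_j`.
[cite: MatomakiRadziwillTao2015, Appendix B (proof of Theorem B.1)] -/
theorem idx_le_of_le_tt {p j : ℕ} (h : p ≤ tt j) : idx p ≤ j := by
  classical
  exact Nat.find_min' (exists_le_tt p) h

/-- Block membership: `t_j < p ≤ t_{j+1}` iff `idx p = j + 1`.
[cite: MatomakiRadziwillTao2015, Appendix B (proof of Theorem B.1)] -/
theorem idx_eq_succ {p j : ℕ} (h1 : tt j < p) (h2 : p ≤ tt (j + 1)) : idx p = j + 1 := by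
  have hle : idx p ≤ j + 1 := idx_le_of_le_tt h2
  have hgt : j < idx p := by
    by_contra h
    push Not at h
    have := le_tt_idx p
    have hmono := tt_mono h
    omega
  omega

/-- The value of `g` at a prime `p`: `p^{i s_{idx p}}`.
[cite: MatomakiRadziwillTao2015, Appendix B (proof of Theorem B.1)] -/
def gp (p : ℕ) : ℂ := Complex.exp (((ss (idx p) * Real.log p : ℝ) : ℂ) * I)

/-- `|g(p)| = 1`. [cite: MatomakiRadziwillTao2015, Appendix B (proof of Theorem B.1)] -/
theorem norm_gp (p : ℕ) : ‖gp p‖ = 1 := norm_phase _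

/-- **The counterexample** `g(n) = μ²(n) ∏_{p ∣ n} p^{i s_{idx p}}`.
[cite: MatomakiRadziwillTao2015, Appendix B (proof of Theorem B.1)] -/
def g : ArithmeticFunction ℂ :=
  ⟨fun n => if Squarefree n then ∏ p ∈ n.primeFactors, gp p else 0, by simp⟩

/-- Unfolding `g`. [cite: MatomakiRadziwillTao2015, Appendix B (proof of Theorem B.1)] -/
theorem g_apply (n : ℕ) : g n = if Squarefree n then ∏ p ∈ n.primeFactors, gp p else 0 := rfl

/-- `g(n) = ∏_{p ∣ n} g(p)` for square-free `n`.
[cite: MatomakiRadziwillTao2015, Appendix B (proof of Theorem B.1)] -/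
theorem g_apply_of_squarefree {n : ℕ} (hn : Squarefree n) : g n = ∏ p ∈ n.primeFactors, gp p := by
  rw [g_apply, if_pos hn]

/-- `g(n) = 0` for `n` not square-free.
[cite: MatomakiRadziwillTao2015, Appendix B (proof of Theorem B.1)] -/
theorem g_apply_of_not_squarefree {n : ℕ} (hn : ¬Squarefree n) : g n = 0 := by
  rw [g_apply, if_neg hn]

/-- `g(p) = p^{i s_{idx p}}` at primes.
[cite: MatomakiRadziwillTao2015, Appendix B (proof of Theorem B.1)] -/
theorem g_prime {p : ℕ} (hp : p.Prime) : g p = gp p := by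
  rw [g_apply_of_squarefree (Irreducible.squarefree hp), hp.primeFactors, Finset.prod_singleton]

/-- `g` is `1`-bounded. [cite: MatomakiRadziwillTao2015, Appendix B (proof of Theorem B.1)] -/
theorem norm_g_le (n : ℕ) : ‖g n‖ ≤ 1 := by
  rw [g_apply]
  split_ifs with h
  · rw [norm_prod]
    exact Finset.prod_le_one (fun _ _ => norm_nonneg _) fun p _ => (norm_gp p).le
  · simp

/-- `g` is multiplicative. [cite: MatomakiRadziwillTao2015, Appendix B (proof of Theorem B.1)] -/
theorem g_isMultiplicative : g.IsMultiplicative := by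
  refine ⟨by rw [g_apply_of_squarefree squarefree_one]; simp, fun {m n} hmn => ?_⟩
  by_cases hm : Squarefree m
  · by_cases hn : Squarefree n
    · have hmn' : Squarefree (m * n) := (Nat.squarefree_mul hmn).2 ⟨hm, hn⟩
      rw [g_apply_of_squarefree hmn', g_apply_of_squarefree hm, g_apply_of_squarefree hn,
        Nat.primeFactors_mul hm.ne_zero hn.ne_zero,
        Finset.prod_union hmn.disjoint_primeFactors]
    · have : ¬Squarefree (m * n) := fun h => hn ((Nat.squarefree_mul hmn).1 h).2
      rw [g_apply_of_not_squarefree this, g_apply_of_not_squarefree hn, mul_zero]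
  · have : ¬Squarefree (m * n) := fun h => hm ((Nat.squarefree_mul hmn).1 h).1
    rw [g_apply_of_not_squarefree this, g_apply_of_not_squarefree hm, zero_mul]

/-! ### `g` is pointwise non-pretentious: `M(g; ∞, ∞) = ∞`

Fix `χ` mod `q ≥ 1`, `t ∈ ℝ`, and put `k = 2φ(q)`. For a prime `p` in block `j` (so `g(p) = p^{is_j}`),
`1 - Re p^{ik(s_j - t)} ≤ k² (1 - Re g(p) conj(χ(p)p^{it}))` (the `k`-trick: `χ(p)^{φ(q)} = 1`), so
`k² 𝔻(g, χ(n)n^{it}; t_m)² ≥ ∑_{j ≤ m} (𝔻(1, n^{iu_j}; t_j)² - 𝔻(1, n^{iu_j}; t_{j-1})²)` with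
`u_j = k(s_j - t)`, and every block with `j ≥ max(q, |t|)` contributes at least `1`. -/

/-- **The `k`-trick, pointwise.** For a prime `p`, `χ` mod `q ≥ 1`, reals `t, S` and `k = 2φ(q)`:
`1 - Re e^{ik(S-t) log p} ≤ k² (1 - Re (e^{iS log p} · conj(χ(p) p^{it})))`. [folklore] -/
theorem kTrick {q : ℕ} (hq : 1 ≤ q) (χ : DirichletCharacter ℂ q) (t S : ℝ) {p : ℕ} (hp : p.Prime) :
    1 - (Complex.exp (((((2 * q.totient : ℕ) : ℝ) * ((S - t) * Real.log p) : ℝ) : ℂ) * I)).re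
      ≤ ((2 * q.totient : ℕ) : ℝ) ^ 2 *
        (1 - (Complex.exp (((S * Real.log p : ℝ) : ℂ) * I)
          * conj (χ p * (p : ℂ) ^ ((t : ℂ) * I))).re) := by
  set k : ℕ := 2 * q.totient with hk
  have htot : 1 ≤ q.totient := Nat.totient_pos.2 hq
  have hk2 : (2 : ℝ) ≤ (k : ℝ) := by
    have : (1 : ℝ) ≤ q.totient := by exact_mod_cast htot
    rw [hk]
    push_cast
    linarith
  rw [natCast_cpow_mul_I hp.pos]
  have hw : Complex.exp (((S * Real.log p : ℝ) : ℂ) * I)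
        * conj (χ p * Complex.exp (((t * Real.log p : ℝ) : ℂ) * I))
      = conj (χ p) * Complex.exp ((((S - t) * Real.log p : ℝ) : ℂ) * I) := by
    rw [map_mul, Literature.NumberTheory.LFunctions.conj_exp_ofReal_mul_I, mul_left_comm, phase_mul_phase,
      show S * Real.log p + -(t * Real.log p) = (S - t) * Real.log p by ring]
  rw [hw]
  have hre1 : |(Complex.exp (((((k : ℝ) * ((S - t) * Real.log p)) : ℝ) : ℂ) * I)).re| ≤ 1 := by
    refine (abs_re_le_norm _).trans ?_
    rw [norm_phase]
  by_cases hu : IsUnit (p : ZMod q)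
  · obtain ⟨u, hu'⟩ := hu
    have hχk : χ (p : ZMod q) ^ k = 1 := by
      rw [hk, pow_mul', ← hu', ← map_pow, ← Units.val_pow_eq_pow_val, ZMod.pow_totient,
        Units.val_one, map_one, one_pow]
    have hχn : ‖χ (p : ZMod q)‖ = 1 := by rw [← hu']; exact χ.unit_norm_eq_one u
    set w : ℂ := conj (χ p) * Complex.exp ((((S - t) * Real.log p : ℝ) : ℂ) * I) with hwdef
    have hwn : ‖w‖ = 1 := by
      rw [hwdef, norm_mul, Complex.norm_conj, hχn, norm_phase, one_mul]
    have hwk : w ^ k = Complex.exp (((((k : ℝ) * ((S - t) * Real.log p)) : ℝ) : ℂ) * I) := by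
      rw [hwdef, mul_pow, ← map_pow, hχk, map_one, one_mul, phase_pow]
    have hwkn : ‖w ^ k‖ = 1 := by rw [norm_pow, hwn, one_pow]
    clear_value w
    have h1 := Literature.NumberTheory.LFunctions.norm_one_sub_pow_le_of_norm_one hwn k
    have h2 : ‖1 - w ^ k‖ ^ 2 ≤ ((k : ℝ) * ‖1 - w‖) ^ 2 := by gcongr
    rw [mul_pow, Literature.NumberTheory.LFunctions.norm_one_sub_sq_of_norm_one hwkn, Literature.NumberTheory.LFunctions.norm_one_sub_sq_of_norm_one hwn, hwk] at h2
    nlinarith [h2]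
  · rw [χ.map_nonunit hu, map_zero, zero_mul, Complex.zero_re, sub_zero, mul_one]
    have := neg_abs_le (Complex.exp (((((k : ℝ) * ((S - t) * Real.log p)) : ℝ) : ℂ) * I)).re
    nlinarith [hre1, hk2]

section Nonpretentious

variable {q : ℕ} (χ : DirichletCharacter ℂ q) (t : ℝ)

/-- The comparison weights `(1 - Re e^{ik(s_{idx p} - t) log p}) / p`, `k = 2φ(q)`.
[cite: MatomakiRadziwillTao2015, Appendix B (proof of Theorem B.1)] -/
def npTerm (q : ℕ) (t : ℝ) (p : ℕ) : ℝ :=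
  (1 - (Complex.exp (((((2 * q.totient : ℕ) : ℝ) * ((ss (idx p) - t) * Real.log p) : ℝ) : ℂ)
    * I)).re) / p

/-- The weights are nonnegative.
[cite: MatomakiRadziwillTao2015, Appendix B (proof of Theorem B.1)] -/
theorem npTerm_nonneg (q : ℕ) (t : ℝ) (p : ℕ) : 0 ≤ npTerm q t p :=
  div_nonneg (one_sub_re_phase_nonneg _) (Nat.cast_nonneg p)

/-- `∑_{p ≤ X} npTerm(p) ≤ k² 𝔻(g, χ(n)n^{it}; X)²` (the `k`-trick summed over `p ≤ X`).
[cite: MatomakiRadziwillTao2015, Appendix B (proof of Theorem B.1)] -/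
theorem sum_npTerm_le (hq : 1 ≤ q) (X : ℕ) :
    ∑ p ∈ Nat.primesLE X, npTerm q t p
      ≤ ((2 * q.totient : ℕ) : ℝ) ^ 2 * Literature.NumberTheory.Sieve.pretentiousDistSq g (Literature.NumberTheory.Sieve.twistedChar χ t) X := by
  unfold Literature.NumberTheory.Sieve.pretentiousDistSq
  rw [Nat.floor_natCast, Finset.mul_sum]
  refine Finset.sum_le_sum fun p hp => ?_
  have hpp := Nat.prime_of_mem_primesLE hp
  have hp0 : (0 : ℝ) < p := by exact_mod_cast hpp.pos
  unfold npTerm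
  rw [← mul_div_assoc]
  refine div_le_div_of_nonneg_right ?_ hp0.le
  have h := kTrick hq χ t (ss (idx p)) hpp
  rw [g_prime hpp]
  exact h

/-- On block `j+1` the weights are the summands of `𝔻(1, n^{iu}; ·)²`, `u = k(s_{j+1} - t)`.
[cite: MatomakiRadziwillTao2015, Appendix B (proof of Theorem B.1)] -/
theorem sum_block_npTerm (j : ℕ) :
    ∑ p ∈ Nat.primesLE (tt (j + 1)) \ Nat.primesLE (tt j), npTerm q t p
      = D1 (((2 * q.totient : ℕ) : ℝ) * (ss (j + 1) - t)) (tt (j + 1))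
        - D1 (((2 * q.totient : ℕ) : ℝ) * (ss (j + 1) - t)) (tt j) := by
  rw [D1_natCast, D1_natCast, ← Finset.sum_sdiff (Nat.primesLE_mono (tt_mono (Nat.le_succ j)))
    (f := fun p : ℕ => (1 - (Complex.exp ((((((2 * q.totient : ℕ) : ℝ) * (ss (j + 1) - t))
      * Real.log p : ℝ) : ℂ) * I)).re) / (p : ℝ)), add_sub_cancel_right]
  refine Finset.sum_congr rfl fun p hp => ?_
  rw [Finset.mem_sdiff, Nat.mem_primesLE, Nat.mem_primesLE] at hp
  obtain ⟨⟨hp1, hpp⟩, hp2⟩ := hp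
  have hgt : tt j < p := by
    by_contra h
    push Not at h
    exact hp2 ⟨h, hpp⟩
  have hidx : idx p = j + 1 := idx_eq_succ hgt hp1
  unfold npTerm
  rw [hidx, show ((2 * q.totient : ℕ) : ℝ) * ((ss (j + 1) - t) * Real.log p)
    = ((2 * q.totient : ℕ) : ℝ) * (ss (j + 1) - t) * Real.log p by ring]

/-- The frequencies `u = k(s_{m+1} - t)` lie in the range `2 ≤ |u| ≤ 4(m+1)s_{m+1}` of the block
construction as soon as `m ≥ q` and `m ≥ |t|`.
[cite: MatomakiRadziwillTao2015, Appendix B (proof of Theorem B.1)] -/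
theorem u_range (hq : 1 ≤ q) {m : ℕ} (hqm : q ≤ m) (htm : |t| ≤ m) :
    2 ≤ |((2 * q.totient : ℕ) : ℝ) * (ss (m + 1) - t)| ∧
      |((2 * q.totient : ℕ) : ℝ) * (ss (m + 1) - t)| ≤ 4 * ((m : ℝ) + 1) * ss (m + 1) := by
  have htot : 1 ≤ q.totient := Nat.totient_pos.2 hq
  have hk2 : (2 : ℝ) ≤ ((2 * q.totient : ℕ) : ℝ) := by
    have : (1 : ℝ) ≤ q.totient := by exact_mod_cast htot
    push_cast
    linarith
  have hkq : ((2 * q.totient : ℕ) : ℝ) ≤ 2 * q := by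
    have : (q.totient : ℝ) ≤ q := by exact_mod_cast Nat.totient_le q
    push_cast
    linarith
  have hqm' : (q : ℝ) ≤ m := by exact_mod_cast hqm
  have hs : (m : ℝ) + 2 ≤ ss (m + 1) := ss_succ_ge m
  have hst : 2 ≤ ss (m + 1) - t := by linarith [le_abs_self t]
  have hpos : 0 < ss (m + 1) - t := by linarith
  have hkpos : (0 : ℝ) < ((2 * q.totient : ℕ) : ℝ) := by linarith
  rw [abs_mul, abs_of_pos hkpos, abs_of_pos hpos]
  constructor
  · nlinarith
  · have h2 : ss (m + 1) - t ≤ 2 * ss (m + 1) := by linarith [neg_abs_le t]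
    calc ((2 * q.totient : ℕ) : ℝ) * (ss (m + 1) - t) ≤ (2 * q) * (2 * ss (m + 1)) :=
          mul_le_mul hkq h2 hpos.le (by linarith [ss_nonneg (m + 1)])
      _ ≤ (2 * m) * (2 * ss (m + 1)) := by
          have : (0 : ℝ) ≤ 2 * ss (m + 1) := by linarith [ss_nonneg (m + 1)]
          gcongr
      _ ≤ 4 * ((m : ℝ) + 1) * ss (m + 1) := by nlinarith [ss_nonneg (m + 1)]

/-- Every block beyond `J = max(q, ⌈|t|⌉)` contributes at least `1`:
`∑_{p ≤ t_m} npTerm(p) ≥ m - J`.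
[cite: MatomakiRadziwillTao2015, Appendix B (proof of Theorem B.1)] -/
theorem sum_npTerm_ge (hq : 1 ≤ q) {J : ℕ} (hJq : q ≤ J) (hJt : |t| ≤ J) (m : ℕ) (hm : J ≤ m) :
    (m : ℝ) - J ≤ ∑ p ∈ Nat.primesLE (tt m), npTerm q t p := by
  induction m, hm using Nat.le_induction with
  | base =>
    rw [sub_self]
    exact Finset.sum_nonneg fun p _ => npTerm_nonneg q t p
  | succ m hm ih =>
    rw [← Finset.sum_sdiff (Nat.primesLE_mono (tt_mono (Nat.le_succ m))), sum_block_npTerm]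
    have hqm : q ≤ m := hJq.trans hm
    have htm : |t| ≤ m := hJt.trans (by exact_mod_cast hm)
    obtain ⟨hu2, huU⟩ := u_range t hq hqm htm
    have hblock := block_ge_one m _ hu2 huU
    rw [Nat.cast_succ]
    linarith

end Nonpretentious

/-- **`M(g; ∞, ∞) = ∞`**: `g` is far from every fixed `χ(n)n^{it}`.
[cite: MatomakiRadziwillTao2015, Appendix B (proof of Theorem B.1)] -/
theorem g_isPointwiseNonpretentious : IsPointwiseNonpretentious (g : ℕ → ℂ) := by
  intro q _ χ t
  have hq : 1 ≤ q := NeZero.one_le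
  set k : ℝ := ((2 * q.totient : ℕ) : ℝ) with hk
  have htot : 1 ≤ q.totient := Nat.totient_pos.2 hq
  have hk2 : (2 : ℝ) ≤ k := by
    have : (1 : ℝ) ≤ q.totient := by exact_mod_cast htot
    rw [hk]
    push_cast
    linarith
  have hkpos : (0 : ℝ) < k ^ 2 := by positivity
  set J : ℕ := max q ⌈|t|⌉₊ with hJ
  have hJq : q ≤ J := le_max_left _ _
  have hJt : |t| ≤ J := (Nat.le_ceil _).trans (by exact_mod_cast le_max_right _ _)
  rw [tendsto_atTop_atTop]
  intro b
  set m : ℕ := J + ⌈b * k ^ 2⌉₊ with hm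
  refine ⟨(tt m : ℝ), fun x hx => ?_⟩
  have h1 : Literature.NumberTheory.Sieve.pretentiousDistSq g (Literature.NumberTheory.Sieve.twistedChar χ t) (tt m) ≤ Literature.NumberTheory.Sieve.pretentiousDistSq g (Literature.NumberTheory.Sieve.twistedChar χ t) x :=
    Literature.NumberTheory.Sieve.pretentiousDistSq_mono norm_g_le (Literature.NumberTheory.Sieve.norm_twistedChar_le_one χ t) hx
  have h2 := sum_npTerm_le χ t hq (tt m)
  have h3 := sum_npTerm_ge t hq hJq hJt m (Nat.le_add_right _ _)
  have h4 : b * k ^ 2 ≤ (m : ℝ) - J := by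
    rw [hm]
    push_cast
    linarith [Nat.le_ceil (b * k ^ 2)]
  have h5 : k ^ 2 * Literature.NumberTheory.Sieve.pretentiousDistSq g (Literature.NumberTheory.Sieve.twistedChar χ t) (tt m)
      ≤ k ^ 2 * Literature.NumberTheory.Sieve.pretentiousDistSq g (Literature.NumberTheory.Sieve.twistedChar χ t) x := mul_le_mul_of_nonneg_left h1 hkpos.le
  have h6 : k ^ 2 * b ≤ k ^ 2 * Literature.NumberTheory.Sieve.pretentiousDistSq g (Literature.NumberTheory.Sieve.twistedChar χ t) x := by linarith
  exact le_of_mul_le_mul_left h6 hkpos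

/-! ### `g(n) ≈ n^{i s_{m+1}}` for square-free `n ≤ t_{m+1}`

For a prime `p ≤ t_j` and `l ≥ j`, `|p^{is_l} - p^{is_j}| ≤ η (2^{-j} - 2^{-l}) / p²` (the shifts
`u_{i} = s_i - s_{i-1}`, `i > j`, move `p^{is}` by at most `η 2^{-i}/(t_{i-1}+1)² ≤ η 2^{-i}/p²`); hence
`|g(p) - p^{is_{m+1}}| ≤ η/p²` for every prime `p ≤ t_{m+1}`, and for square-free `n ≤ t_{m+1}`,
`|g(n) - n^{is_{m+1}}| ≤ ∑_{p ∣ n} η/p² ≤ η`. -/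

/-- Drift of `p^{is_l}` along the stages: `|p^{is_l} - p^{is_j}| ≤ η(2^{-j} - 2^{-l})/p²` for a prime
`p ≤ t_j` and `l ≥ j`. [cite: MatomakiRadziwillTao2015, Appendix B (proof of Theorem B.1)] -/
theorem phase_drift (j : ℕ) {p : ℕ} (hp : p ∈ Nat.primesLE (tt j)) (l : ℕ) (hjl : j ≤ l) :
    ‖Complex.exp (((ss l * Real.log p : ℝ) : ℂ) * I) - Complex.exp (((ss j * Real.log p : ℝ) : ℂ) * I)‖
      ≤ 1 / 100 * ((1 / 2) ^ j - (1 / 2) ^ l) / (p : ℝ) ^ 2 := by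
  have hpp := Nat.prime_of_mem_primesLE hp
  have hpj := Nat.le_of_mem_primesLE hp
  have hp0 : (0 : ℝ) < p := by exact_mod_cast hpp.pos
  induction l, hjl using Nat.le_induction with
  | base => simp
  | succ l hl ih =>
    have hpl : p ∈ Nat.primesLE (tt l) := Nat.mem_primesLE.2 ⟨hpj.trans (tt_mono hl), hpp⟩
    have hsm := shift_small l hpl
    have hpT : (p : ℝ) ≤ (tt l : ℝ) + 1 := by
      have : (p : ℝ) ≤ tt l := by exact_mod_cast hpj.trans (tt_mono hl)
      linarith
    have e : Complex.exp (((ss (l + 1) * Real.log p : ℝ) : ℂ) * I)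
        = Complex.exp (((ss l * Real.log p : ℝ) : ℂ) * I)
          * Complex.exp ((((ss (l + 1) - ss l) * Real.log p : ℝ) : ℂ) * I) := by
      rw [phase_mul_phase, show ss l * Real.log p + (ss (l + 1) - ss l) * Real.log p
        = ss (l + 1) * Real.log p by ring]
    have step : ‖Complex.exp (((ss (l + 1) * Real.log p : ℝ) : ℂ) * I)
        - Complex.exp (((ss l * Real.log p : ℝ) : ℂ) * I)‖
          ≤ 1 / 100 * (1 / 2) ^ (l + 1) / (p : ℝ) ^ 2 := by
      rw [e, ← mul_sub_one, norm_mul, norm_phase, one_mul]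
      refine hsm.trans ?_
      gcongr
    calc ‖Complex.exp (((ss (l + 1) * Real.log p : ℝ) : ℂ) * I)
          - Complex.exp (((ss j * Real.log p : ℝ) : ℂ) * I)‖
        ≤ ‖Complex.exp (((ss (l + 1) * Real.log p : ℝ) : ℂ) * I)
            - Complex.exp (((ss l * Real.log p : ℝ) : ℂ) * I)‖
          + ‖Complex.exp (((ss l * Real.log p : ℝ) : ℂ) * I)
            - Complex.exp (((ss j * Real.log p : ℝ) : ℂ) * I)‖ := norm_sub_le_norm_sub_add_norm_sub _ _ _
      _ ≤ 1 / 100 * (1 / 2) ^ (l + 1) / (p : ℝ) ^ 2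
          + 1 / 100 * ((1 / 2) ^ j - (1 / 2) ^ l) / (p : ℝ) ^ 2 := add_le_add step ih
      _ = 1 / 100 * ((1 / 2) ^ j - (1 / 2) ^ (l + 1)) / (p : ℝ) ^ 2 := by ring

/-- `|g(p) - p^{is_{m+1}}| ≤ η/p²` for every prime `p ≤ t_{m+1}`.
[cite: MatomakiRadziwillTao2015, Appendix B (proof of Theorem B.1)] -/
theorem gp_near (m : ℕ) {p : ℕ} (hpp : p.Prime) (hp : p ≤ tt (m + 1)) :
    ‖gp p - Complex.exp (((ss (m + 1) * Real.log p : ℝ) : ℂ) * I)‖ ≤ 1 / 100 / (p : ℝ) ^ 2 := by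
  have hj : idx p ≤ m + 1 := idx_le_of_le_tt hp
  have hmem : p ∈ Nat.primesLE (tt (idx p)) := Nat.mem_primesLE.2 ⟨le_tt_idx p, hpp⟩
  have h := phase_drift (idx p) hmem (m + 1) hj
  rw [norm_sub_rev] at h
  unfold gp
  refine h.trans ?_
  have h1 : (1 / 2 : ℝ) ^ (idx p) ≤ 1 := pow_le_one₀ (by norm_num) (by norm_num)
  have h2 : (0 : ℝ) ≤ (1 / 2) ^ (m + 1) := by positivity
  have hp2 : (0 : ℝ) < (p : ℝ) ^ 2 := by have := hpp.pos; positivity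
  rw [div_le_div_iff_of_pos_right hp2]
  nlinarith

/-- `∑_{k ∈ S} 1/k² ≤ 1` for a finite set `S` of integers `≥ 2`. [folklore] -/
theorem sum_inv_sq_le_one (S : Finset ℕ) (hS : ∀ k ∈ S, 2 ≤ k) :
    ∑ k ∈ S, (1 : ℝ) / (k : ℝ) ^ 2 ≤ 1 := by
  have hsub : S ⊆ Finset.Icc (1 + 1) (S.sup id) := by
    intro k hk
    rw [Finset.mem_Icc]
    exact ⟨hS k hk, Finset.le_sup (f := id) hk⟩
  calc ∑ k ∈ S, (1 : ℝ) / (k : ℝ) ^ 2 ≤ ∑ k ∈ Finset.Icc (1 + 1) (S.sup id), (1 : ℝ) / (k : ℝ) ^ 2 :=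
        Finset.sum_le_sum_of_subset_of_nonneg hsub fun _ _ _ => by positivity
    _ ≤ 1 / ((1 : ℕ) : ℝ) := sum_Icc_inv_sq_le 1 _ le_rfl
    _ = 1 := by norm_num

/-- **`|g(n) - n^{is_{m+1}}| ≤ η`** for square-free `n ≤ t_{m+1}`.
[cite: MatomakiRadziwillTao2015, Appendix B (proof of Theorem B.1)] -/
theorem g_near (m : ℕ) {n : ℕ} (hn : Squarefree n) (hnT : n ≤ tt (m + 1)) :
    ‖g n - Complex.exp (((ss (m + 1) * Real.log n : ℝ) : ℂ) * I)‖ ≤ 1 / 100 := by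
  rw [g_apply_of_squarefree hn]
  have hlog : Real.log n = ∑ p ∈ n.primeFactors, Real.log p := by
    conv_lhs => rw [← Nat.prod_primeFactors_of_squarefree hn]
    rw [Nat.cast_prod, Real.log_prod]
    intro p hp
    exact_mod_cast (Nat.prime_of_mem_primeFactors hp).ne_zero
  have hexp : Complex.exp (((ss (m + 1) * Real.log n : ℝ) : ℂ) * I)
      = ∏ p ∈ n.primeFactors, Complex.exp (((ss (m + 1) * Real.log p : ℝ) : ℂ) * I) := by
    rw [← Complex.exp_sum, hlog, Finset.mul_sum]
    congr 1
    push_cast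
    rw [Finset.sum_mul]
  rw [hexp]
  calc ‖∏ p ∈ n.primeFactors, gp p
        - ∏ p ∈ n.primeFactors, Complex.exp (((ss (m + 1) * Real.log p : ℝ) : ℂ) * I)‖
      ≤ ∑ p ∈ n.primeFactors, ‖gp p - Complex.exp (((ss (m + 1) * Real.log p : ℝ) : ℂ) * I)‖ :=
        norm_prod_sub_prod_le _ (fun p _ => (norm_gp p).le) (fun p _ => (norm_phase _).le)
    _ ≤ ∑ p ∈ n.primeFactors, 1 / 100 / (p : ℝ) ^ 2 :=
        Finset.sum_le_sum fun p hp => gp_near m (Nat.prime_of_mem_primeFactors hp)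
          ((Nat.le_of_mem_primeFactors hp).trans hnT)
    _ = 1 / 100 * ∑ p ∈ n.primeFactors, 1 / (p : ℝ) ^ 2 := by
        rw [Finset.mul_sum]
        refine Finset.sum_congr rfl fun p _ => ?_
        ring
    _ ≤ 1 / 100 * 1 := by
        gcongr
        exact sum_inv_sq_le_one _ fun p hp => (Nat.prime_of_mem_primeFactors hp).two_le
    _ = 1 / 100 := by norm_num

/-! ### Consecutive square-free integers have positive density

`#{n ≤ X : n, n+1 square-free} ≥ X - ∑_p (⌊X/p²⌋ + ⌊(X+1)/p²⌋) ≥ X - (2X+1) ∑_p p^{-2}` and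
`∑_p p^{-2} ≤ ∑_{p ≤ 23} p^{-2} + ∑_{k ≥ 29} k^{-2} ≤ 0.444 + 1/28 ≤ 0.48`. -/

/-- `#{1 ≤ n ≤ X : d ∣ n} ≤ X/d`. [folklore] -/
theorem card_filter_dvd_le (X d : ℕ) (hd : 0 < d) :
    ((#{n ∈ Finset.Icc 1 X | d ∣ n} : ℕ) : ℝ) ≤ X / d := by
  have h : #{n ∈ Finset.Icc 1 X | d ∣ n} ≤ #(Finset.Icc 1 (X / d)) := by
    refine Finset.card_le_card_of_injOn (fun n => n / d) ?_ ?_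
    · intro n hn
      simp only [Finset.coe_filter, Finset.mem_Icc, Set.mem_setOf_eq] at hn
      obtain ⟨⟨h1, h2⟩, hdn⟩ := hn
      simp only [Finset.coe_Icc, Set.mem_Icc]
      exact ⟨Nat.div_pos (Nat.le_of_dvd h1 hdn) hd, Nat.div_le_div_right h2⟩
    · intro a ha b hb hab
      simp only [Finset.coe_filter, Finset.mem_Icc, Set.mem_setOf_eq] at ha hb
      simp only at hab
      rw [← Nat.div_mul_cancel ha.2, ← Nat.div_mul_cancel hb.2, hab]
  calc ((#{n ∈ Finset.Icc 1 X | d ∣ n} : ℕ) : ℝ) ≤ #(Finset.Icc 1 (X / d)) := by exact_mod_cast h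
    _ = ((X / d : ℕ) : ℝ) := by simp
    _ ≤ X / d := Nat.cast_div_le

/-- `#{1 ≤ n ≤ X : d ∣ n + 1} ≤ (X+1)/d`. [folklore] -/
theorem card_filter_dvd_succ_le (X d : ℕ) (hd : 0 < d) :
    ((#{n ∈ Finset.Icc 1 X | d ∣ n + 1} : ℕ) : ℝ) ≤ ((X : ℝ) + 1) / d := by
  have h : #{n ∈ Finset.Icc 1 X | d ∣ n + 1} ≤ #{n ∈ Finset.Icc 1 (X + 1) | d ∣ n} := by
    refine Finset.card_le_card_of_injOn (fun n => n + 1) ?_ ?_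
    · intro n hn
      simp only [Finset.coe_filter, Finset.mem_Icc, Set.mem_setOf_eq] at hn ⊢
      exact ⟨⟨by omega, by omega⟩, hn.2⟩
    · intro a _ b _ hab
      simpa using hab
  calc ((#{n ∈ Finset.Icc 1 X | d ∣ n + 1} : ℕ) : ℝ) ≤ #{n ∈ Finset.Icc 1 (X + 1) | d ∣ n} := by
        exact_mod_cast h
    _ ≤ ((X + 1 : ℕ) : ℝ) / d := card_filter_dvd_le (X + 1) d hd
    _ = ((X : ℝ) + 1) / d := by push_cast; ring

/-- `∑_{p ∈ S} 1/p² ≤ 0.48` for every finite set `S` of primes. [folklore] -/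
theorem sum_primes_inv_sq_le (S : Finset ℕ) (hS : ∀ p ∈ S, p.Prime) :
    ∑ p ∈ S, (1 : ℝ) / (p : ℝ) ^ 2 ≤ 0.48 := by
  classical
  rw [← Finset.sum_filter_add_sum_filter_not S (fun p => p < 29)]
  have h1 : ∑ p ∈ S.filter (fun p => p < 29), (1 : ℝ) / (p : ℝ) ^ 2
      ≤ ∑ p ∈ (Finset.range 29).filter Nat.Prime, (1 : ℝ) / (p : ℝ) ^ 2 := by
    apply Finset.sum_le_sum_of_subset_of_nonneg
    · intro p hp
      rw [Finset.mem_filter] at hp ⊢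
      exact ⟨Finset.mem_range.2 hp.2, hS p hp.1⟩
    · intro _ _ _
      positivity
  have h2 : ∑ p ∈ (Finset.range 29).filter Nat.Prime, (1 : ℝ) / (p : ℝ) ^ 2 ≤ 0.444 := by
    rw [Finset.sum_filter]
    simp only [Finset.sum_range_succ, Finset.sum_range_zero]
    norm_num
  have h3 : ∑ p ∈ S.filter (fun p => ¬p < 29), (1 : ℝ) / (p : ℝ) ^ 2 ≤ 1 / ((28 : ℕ) : ℝ) := by
    have hsub : S.filter (fun p => ¬p < 29) ⊆ Finset.Icc (28 + 1) (S.sup id) := by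
      intro p hp
      rw [Finset.mem_filter] at hp
      rw [Finset.mem_Icc]
      exact ⟨by omega, Finset.le_sup (f := id) hp.1⟩
    calc ∑ p ∈ S.filter (fun p => ¬p < 29), (1 : ℝ) / (p : ℝ) ^ 2
        ≤ ∑ k ∈ Finset.Icc (28 + 1) (S.sup id), (1 : ℝ) / (k : ℝ) ^ 2 :=
          Finset.sum_le_sum_of_subset_of_nonneg hsub fun _ _ _ => by positivity
      _ ≤ 1 / ((28 : ℕ) : ℝ) := sum_Icc_inv_sq_le 28 _ (by norm_num)
  have h4 : (1 : ℝ) / ((28 : ℕ) : ℝ) ≤ 0.036 := by norm_num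
  linarith

/-- **Positive density of consecutive square-free integers**:
`#{1 ≤ n ≤ X : n, n+1 square-free} ≥ X/40 - 1`. [folklore] -/
theorem card_sqfreePairs_ge (X : ℕ) :
    (X : ℝ) / 40 - 1 ≤ #{n ∈ Finset.Icc 1 X | Squarefree n ∧ Squarefree (n + 1)} := by
  classical
  set S := Finset.Icc 1 X with hSdef
  have hcard : #{n ∈ S | Squarefree n ∧ Squarefree (n + 1)}
      + #{n ∈ S | ¬(Squarefree n ∧ Squarefree (n + 1))} = X := by
    rw [Finset.card_filter_add_card_filter_not]
    simp [hSdef]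
  have hbad : S.filter (fun n => ¬(Squarefree n ∧ Squarefree (n + 1)))
      ⊆ (Nat.primesLE (X + 1)).biUnion
          (fun p => S.filter (fun n => p * p ∣ n) ∪ S.filter (fun n => p * p ∣ n + 1)) := by
    intro n hn
    rw [Finset.mem_filter] at hn
    obtain ⟨hnS, hnP⟩ := hn
    have hnS' := hnS
    rw [hSdef, Finset.mem_Icc] at hnS'
    rw [Finset.mem_biUnion]
    by_cases h1 : Squarefree n
    · have h2 : ¬Squarefree (n + 1) := fun h => hnP ⟨h1, h⟩
      rw [Nat.squarefree_iff_prime_squarefree] at h2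
      push Not at h2
      obtain ⟨p, hp, hdvd⟩ := h2
      refine ⟨p, Nat.mem_primesLE.2 ⟨?_, hp⟩, ?_⟩
      · have := Nat.le_of_dvd (Nat.succ_pos n) hdvd
        have := Nat.le_mul_self p
        omega
      · rw [Finset.mem_union, Finset.mem_filter, Finset.mem_filter]
        exact Or.inr ⟨hnS, hdvd⟩
    · rw [Nat.squarefree_iff_prime_squarefree] at h1
      push Not at h1
      obtain ⟨p, hp, hdvd⟩ := h1
      refine ⟨p, Nat.mem_primesLE.2 ⟨?_, hp⟩, ?_⟩
      · have := Nat.le_of_dvd (by omega) hdvd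
        have := Nat.le_mul_self p
        omega
      · rw [Finset.mem_union, Finset.mem_filter, Finset.mem_filter]
        exact Or.inl ⟨hnS, hdvd⟩
  have hbadcard : ((#(S.filter (fun n => ¬(Squarefree n ∧ Squarefree (n + 1)))) : ℕ) : ℝ)
      ≤ (2 * X + 1) * 0.48 := by
    calc ((#(S.filter (fun n => ¬(Squarefree n ∧ Squarefree (n + 1)))) : ℕ) : ℝ)
        ≤ #((Nat.primesLE (X + 1)).biUnion
            (fun p => S.filter (fun n => p * p ∣ n) ∪ S.filter (fun n => p * p ∣ n + 1))) := by
          exact_mod_cast Finset.card_le_card hbad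
      _ ≤ ∑ p ∈ Nat.primesLE (X + 1),
            ((#(S.filter (fun n => p * p ∣ n) ∪ S.filter (fun n => p * p ∣ n + 1)) : ℕ) : ℝ) := by
          exact_mod_cast Finset.card_biUnion_le
      _ ≤ ∑ p ∈ Nat.primesLE (X + 1), ((X : ℝ) / (p * p : ℕ) + ((X : ℝ) + 1) / (p * p : ℕ)) := by
          refine Finset.sum_le_sum fun p hp => ?_
          have hpp := Nat.prime_of_mem_primesLE hp
          have hpos : 0 < p * p := Nat.mul_pos hpp.pos hpp.pos
          calc ((#(S.filter (fun n => p * p ∣ n) ∪ S.filter (fun n => p * p ∣ n + 1)) : ℕ) : ℝ)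
              ≤ ((#(S.filter (fun n => p * p ∣ n)) : ℕ) : ℝ)
                + ((#(S.filter (fun n => p * p ∣ n + 1)) : ℕ) : ℝ) := by
                exact_mod_cast Finset.card_union_le _ _
            _ ≤ (X : ℝ) / (p * p : ℕ) + ((X : ℝ) + 1) / (p * p : ℕ) :=
                add_le_add (card_filter_dvd_le X (p * p) hpos) (card_filter_dvd_succ_le X (p * p) hpos)
      _ = (2 * X + 1) * ∑ p ∈ Nat.primesLE (X + 1), (1 : ℝ) / (p : ℝ) ^ 2 := by
          rw [Finset.mul_sum]
          refine Finset.sum_congr rfl fun p hp => ?_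
          have hp0 : (p : ℝ) ≠ 0 := by exact_mod_cast (Nat.prime_of_mem_primesLE hp).ne_zero
          push_cast
          field_simp
          ring
      _ ≤ (2 * X + 1) * 0.48 := by
          gcongr
          exact sum_primes_inv_sq_le _ fun p hp => Nat.prime_of_mem_primesLE hp
  have hgood : ((#{n ∈ S | Squarefree n ∧ Squarefree (n + 1)} : ℕ) : ℝ)
      = X - #{n ∈ S | ¬(Squarefree n ∧ Squarefree (n + 1))} := by
    have := congrArg (Nat.cast (R := ℝ)) hcard
    push_cast at this
    linarith
  rw [hgood]
  linarith

/-! ### The correlation `∑_{n ≤ t_{m+1}} g(n) conj g(n+1)` is large -/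

/-- `Re z ≥ 1 - |z - 1|`. [folklore] -/
theorem re_ge_of_norm_sub_one_le {z : ℂ} {δ : ℝ} (h : ‖z - 1‖ ≤ δ) : 1 - δ ≤ z.re := by
  have h1 := Complex.re_le_norm (1 - z)
  rw [norm_sub_rev] at h1
  simp only [Complex.sub_re, Complex.one_re] at h1
  linarith

/-- For `n, n+1` square-free, `n + 1 ≤ t_{m+1}` and `n ≥ 100 s_{m+1}`:
`|g(n) conj g(n+1) - 1| ≤ 3η`.
[cite: MatomakiRadziwillTao2015, Appendix B (proof of Theorem B.1)] -/
theorem corr_term_near (m : ℕ) {n : ℕ} (hn : Squarefree n) (hn1 : Squarefree (n + 1))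
    (hnT : n + 1 ≤ tt (m + 1)) (hn0 : 100 * ss (m + 1) ≤ n) :
    ‖g n * conj (g (n + 1)) - 1‖ ≤ 3 / 100 := by
  set s : ℝ := ss (m + 1) with hs
  have hs2 : 2 ≤ s := by
    have := ss_succ_ge m
    have : (0 : ℝ) ≤ m := Nat.cast_nonneg m
    linarith
  have hnpos : (0 : ℝ) < n := by linarith
  set e : ℕ → ℂ := fun x => Complex.exp (((s * Real.log x : ℝ) : ℂ) * I) with he
  have h1 : ‖g n - e n‖ ≤ 1 / 100 := g_near m hn (by omega)
  have h2 : ‖g (n + 1) - e (n + 1)‖ ≤ 1 / 100 := g_near m hn1 hnT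
  have h3 : ‖e n * conj (e (n + 1)) - 1‖ ≤ 1 / 100 := by
    simp only [he]
    rw [Literature.NumberTheory.LFunctions.conj_exp_ofReal_mul_I, phase_mul_phase]
    refine (norm_phase_sub_one_le _).trans ?_
    have hlog : Real.log ((n + 1 : ℕ) : ℝ) - Real.log n ≤ 1 / n := by
      push_cast
      rw [← Real.log_div (by positivity) hnpos.ne']
      have h := Real.log_le_sub_one_of_pos (x := ((n : ℝ) + 1) / n) (by positivity)
      have e : ((n : ℝ) + 1) / n - 1 = 1 / n := by
        field_simp
        ring
      linarith
    have hlog0 : 0 ≤ Real.log ((n + 1 : ℕ) : ℝ) - Real.log n := by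
      push_cast
      exact sub_nonneg.2 (Real.log_le_log hnpos (by linarith))
    rw [show s * Real.log n + -(s * Real.log ((n + 1 : ℕ) : ℝ))
        = -(s * (Real.log ((n + 1 : ℕ) : ℝ) - Real.log n)) by ring, abs_neg,
      abs_of_nonneg (by positivity)]
    calc s * (Real.log ((n + 1 : ℕ) : ℝ) - Real.log n) ≤ s * (1 / n) := by gcongr
      _ ≤ 1 / 100 := by
          rw [mul_one_div, div_le_iff₀ hnpos]
          linarith
  have key : g n * conj (g (n + 1)) - 1 = (g n - e n) * conj (g (n + 1))
      + e n * conj (g (n + 1) - e (n + 1)) + (e n * conj (e (n + 1)) - 1) := by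
    simp only [map_sub]
    ring
  rw [key]
  calc ‖(g n - e n) * conj (g (n + 1)) + e n * conj (g (n + 1) - e (n + 1))
        + (e n * conj (e (n + 1)) - 1)‖
      ≤ ‖(g n - e n) * conj (g (n + 1))‖ + ‖e n * conj (g (n + 1) - e (n + 1))‖
        + ‖e n * conj (e (n + 1)) - 1‖ := norm_add₃_le
    _ ≤ 1 / 100 * 1 + 1 * (1 / 100) + 1 / 100 := by
        gcongr
        · rw [norm_mul, Complex.norm_conj]
          exact mul_le_mul h1 (norm_g_le _) (norm_nonneg _) (by norm_num)
        · rw [norm_mul, Complex.norm_conj]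
          exact mul_le_mul (norm_phase _).le h2 (norm_nonneg _) (by norm_num)
    _ = 3 / 100 := by norm_num

/-- **The correlation is large**: `|∑_{n ≤ t_{m+1}} g(n) conj g(n+1)| ≥ t_{m+1}/50` for every `m`.
[cite: MatomakiRadziwillTao2015, Appendix B (proof of Theorem B.1)] -/
theorem corr_lower (m : ℕ) :
    (1 / 50 : ℝ) * (tt (m + 1) : ℝ) ≤ ‖∑ n ∈ Finset.Icc 1 (tt (m + 1)), g n * conj (g (n + 1))‖ := by
  classical
  set T : ℕ := tt (m + 1) with hT
  set s : ℝ := ss (m + 1) with hs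
  have hs2 : 2 ≤ s := by
    have := ss_succ_ge m
    have : (0 : ℝ) ≤ m := Nat.cast_nonneg m
    linarith
  have hTs : 60000 * (s + 1) ≤ (T : ℝ) := tt_succ_ge m
  have hT1 : 1 ≤ T := by
    have : (1 : ℝ) ≤ T := by linarith
    exact_mod_cast this
  set n₀ : ℕ := ⌈100 * s⌉₊ with hn₀def
  have hn₀ : (n₀ : ℝ) ≤ 100 * s + 1 := (Nat.ceil_lt_add_one (by positivity)).le
  have hn₀' : 100 * s ≤ n₀ := Nat.le_ceil _
  refine le_trans ?_ (Complex.re_le_norm _)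
  rw [Complex.re_sum]
  set F : ℕ → ℝ := fun n => (g n * conj (g (n + 1))).re with hF
  set Good := (Finset.Icc 1 (T - 1)).filter
    (fun n => Squarefree n ∧ Squarefree (n + 1) ∧ n₀ ≤ n) with hGood
  have hGoodsub : Good ⊆ Finset.Icc 1 T := by
    intro n hn
    rw [hGood, Finset.mem_filter, Finset.mem_Icc] at hn
    rw [Finset.mem_Icc]
    omega
  have hF_good : ∀ n ∈ Good, (97 / 100 : ℝ) ≤ F n := by
    intro n hn
    rw [hGood, Finset.mem_filter, Finset.mem_Icc] at hn
    obtain ⟨⟨hn1, hnT⟩, hsf, hsf1, hnn₀⟩ := hn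
    have hge : 100 * ss (m + 1) ≤ n := by
      have : (n₀ : ℝ) ≤ n := by exact_mod_cast hnn₀
      linarith
    have h := corr_term_near m hsf hsf1 (by omega) hge
    have := re_ge_of_norm_sub_one_le h
    simp only [hF]
    linarith
  have hF_rest : ∀ n ∈ Finset.Icc 1 T \ Good,
      -(if n < n₀ ∨ n = T then (1 : ℝ) else 0) ≤ F n := by
    intro n hn
    rw [Finset.mem_sdiff] at hn
    obtain ⟨hnI, hnG⟩ := hn
    split_ifs with hc
    · have : |F n| ≤ 1 := by
        refine (abs_re_le_norm _).trans ?_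
        rw [norm_mul, Complex.norm_conj]
        exact mul_le_one₀ (norm_g_le n) (norm_nonneg _) (norm_g_le _)
      linarith [neg_abs_le (F n)]
    · push Not at hc
      have hsf : ¬(Squarefree n ∧ Squarefree (n + 1)) := by
        intro h
        apply hnG
        rw [Finset.mem_Icc] at hnI
        rw [hGood, Finset.mem_filter, Finset.mem_Icc]
        exact ⟨⟨hnI.1, by omega⟩, h.1, h.2, hc.1⟩
      have hF0 : F n = 0 := by
        simp only [hF]
        rcases not_and_or.1 hsf with h | h
        · rw [g_apply_of_not_squarefree h]
          simp
        · rw [g_apply_of_not_squarefree h]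
          simp
      rw [hF0]
      simp
  have hsplit : ∑ n ∈ Finset.Icc 1 T, F n
      = ∑ n ∈ Good, F n + ∑ n ∈ Finset.Icc 1 T \ Good, F n := by
    rw [← Finset.sum_sdiff hGoodsub, add_comm]
  have hsum_good : (97 / 100 : ℝ) * #Good ≤ ∑ n ∈ Good, F n := by
    have := Finset.card_nsmul_le_sum Good F (97 / 100) hF_good
    rw [nsmul_eq_mul] at this
    linarith
  have hsum_rest : -((n₀ : ℝ) + 1) ≤ ∑ n ∈ Finset.Icc 1 T \ Good, F n := by
    have h1 : ∑ n ∈ Finset.Icc 1 T \ Good, -(if n < n₀ ∨ n = T then (1 : ℝ) else 0)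
        ≤ ∑ n ∈ Finset.Icc 1 T \ Good, F n := Finset.sum_le_sum hF_rest
    have h2 : ∑ n ∈ Finset.Icc 1 T \ Good, (if n < n₀ ∨ n = T then (1 : ℝ) else 0)
        ≤ (n₀ : ℝ) + 1 := by
      calc ∑ n ∈ Finset.Icc 1 T \ Good, (if n < n₀ ∨ n = T then (1 : ℝ) else 0)
          ≤ ∑ n ∈ Finset.Icc 1 T, (if n < n₀ ∨ n = T then (1 : ℝ) else 0) :=
            Finset.sum_le_sum_of_subset_of_nonneg Finset.sdiff_subset fun _ _ _ => by
              split_ifs <;> norm_num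
        _ = #((Finset.Icc 1 T).filter (fun n => n < n₀ ∨ n = T)) := by
            rw [Finset.sum_boole]
        _ ≤ #(Finset.range n₀ ∪ {T}) := by
            exact_mod_cast Finset.card_le_card (by
              intro n hn
              rw [Finset.mem_filter] at hn
              rw [Finset.mem_union, Finset.mem_range, Finset.mem_singleton]
              exact hn.2)
        _ ≤ ((#(Finset.range n₀) + #({T} : Finset ℕ) : ℕ) : ℝ) := by
            exact_mod_cast Finset.card_union_le _ _
        _ = (n₀ : ℝ) + 1 := by simp
    rw [Finset.sum_neg_distrib] at h1
    linarith
  have hGood_card : ((T : ℝ) - 1) / 40 - 1 - n₀ ≤ #Good := by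
    have hsf := card_sqfreePairs_ge (T - 1)
    have hcast : ((T - 1 : ℕ) : ℝ) = (T : ℝ) - 1 := by
      rw [Nat.cast_sub hT1, Nat.cast_one]
    rw [hcast] at hsf
    have hsub : (Finset.Icc 1 (T - 1)).filter (fun n => Squarefree n ∧ Squarefree (n + 1))
        ⊆ Good ∪ Finset.range n₀ := by
      intro n hn
      rw [Finset.mem_filter] at hn
      rw [Finset.mem_union, hGood, Finset.mem_filter, Finset.mem_range]
      by_cases h : n₀ ≤ n
      · exact Or.inl ⟨hn.1, hn.2.1, hn.2.2, h⟩
      · exact Or.inr (by omega)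
    have h1 := Finset.card_le_card hsub
    have h2 := Finset.card_union_le Good (Finset.range n₀)
    rw [Finset.card_range] at h2
    have h3 : ((#((Finset.Icc 1 (T - 1)).filter (fun n => Squarefree n ∧ Squarefree (n + 1))) : ℕ) : ℝ)
        ≤ #Good + n₀ := by exact_mod_cast h1.trans h2
    linarith
  rw [hsplit]
  linarith

/-! ### Theorem B.1 and the refutation of Elliott's conjecture in its original form -/

end Literature.Barriers.Parity.MRTCounterexample

namespace Literature.Barriers.Parity

open MRTCounterexample in
/-- **DISCHARGE of `MatomakiRadziwillTao2015_counterexample` (Matomäki–Radziwiłł–Tao 2015,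
Theorem B.1).** The function `g = MRTCounterexample.g` is `1`-bounded, multiplicative, satisfies
`M(g; ∞, ∞) = ∞`, and `|∑_{n ≤ t_{m+1}} g(n) conj g(n+1)| ≥ t_{m+1}/50` along the heights
`t_{m+1} → ∞` of its construction. [cite: MatomakiRadziwillTao2015, Appendix B, Theorem B.1] -/
theorem MatomakiRadziwillTao2015_counterexample_holds : MatomakiRadziwillTao2015_counterexample := by
  refine ⟨g, g_isMultiplicative, norm_g_le, g_isPointwiseNonpretentious, fun m => tt (m + 1), 1 / 50,
    ?_, by norm_num, Filter.Eventually.of_forall corr_lower⟩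
  exact (tendsto_add_atTop_iff_nat 1).2 tt_strictMono.tendsto_atTop

-- names the `@[deprecated]` tombstone `ElliottConjectureOriginal` of `ElliottOriginalForm.lean` on purpose: this IS
-- its refutation (verdict clean-up 2026-08-16); REMOVE-WHEN the tombstone is deleted from `ElliottOriginalForm.lean`
set_option linter.deprecated false in
/-- **Elliott's conjecture in its original form (MRT Conjecture 1.5 with hypothesis (1.6)) is
false**, unconditionally: Theorem B.1 (`MatomakiRadziwillTao2015_counterexample_holds`) and
`MatomakiRadziwillTao2015_counterexample.not_elliottConjectureOriginal`.
[cite: MatomakiRadziwillTao2015, Conjecture 1.5 and Appendix B, Theorem B.1] -/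
theorem ElliottConjectureOriginal_false : ¬ElliottConjectureOriginal :=
  MatomakiRadziwillTao2015_counterexample_holds.not_elliottConjectureOriginal

end Literature.Barriers.Parity
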